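import Literature.Analysis.SpecialFunctions.JacobiNomeInversion
import Literature.Analysis.SpecialFunctions.JacobiThetaAxisDerivatives
import HarnessLib

/-!
# Glaisher's identity in `K`-form: `∑_{(m,n)∈ℤ²} (m⁴ − 6m²n² + n⁴) q^{m²+n²} = (8/π⁵) k²k′²K⁵`

Topic `Literature/Analysis/SpecialFunctions`. For `0 < k < 1` let `K = K(k)`, `K′ = K(k′)`,
`k′ = √(1−k²)`, `E = E(k)` (the tree's `completeEllipticK`, `completeEllipticE`), `σ = K′/K` and
`q = e^{−πσ}`. With `θ(y) = ∑ₙ e^{−πn²y} = θ₃(iy)`, Jacobi's inversion theorem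
(`JacobiNomeInversion.lean`) reads `θ(σ(k))² = (2/π)K(k)`. Differentiating this identity twice
along `k ↦ σ(k)` — using `dσ/dk = −π/(2kk′²K²)` (`EllipticPeriodRatioDeriv.lean`), Lawden's
`dK/dk = (E − k′²K)/(kk′²)`, `dE/dk = (E − K)/k` ((3.8.12), (3.8.7); `LegendreRelation.lean` in the
parameter `m = k²`) and the termwise derivatives `θ′, θ″` (`JacobiThetaAxisDerivatives.lean`) — gives

* `theta_sq_periodRatio`:      `θ(σ)² = (2/π) K`,
* `theta_mul_deriv_periodRatio`: `θ(σ)θ′(σ) = −(2/π²) K²(E − k′²K)`,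
* `glaisher_combination_periodRatio`: `2θ(σ)θ″(σ) − 6θ′(σ)² = (8/π³) k²k′²K⁵`,

and therefore, by the factorization `∑_{(m,n)}(m⁴−6m²n²+n⁴)e^{−π(m²+n²)y} = (2θθ″ − 6θ′²)/π²`,

* **`glaisherLatticeSum_periodRatio`**:
  `∑_{(m,n)∈ℤ²} (m⁴ − 6m²n² + n⁴) e^{−π(m²+n²)K′/K} = (8/π⁵) k²(1−k²)K(k)⁵`.

This is the weight-5 case of Glaisher's expressions of the lattice sums `∑(m+in)^{4ℓ}q^{m²+n²}`
through `k, k′, K` (Glaisher 1885), in the symmetric normalisation `q = e^{−πK′/K}`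
(Rogers–Wan–Zucker, arXiv:1303.2259, §3, state the two-level form
`¼∑(n−im)⁴q^{n²+m²} ↔ kk′²K⁵` with `q = e^{−πK′/(2K)}`-type conventions); it is the bridge from the
cubic moment `∫₀¹ kK′³dk` to Hurwitz's lattice sum `∑′(mi+n)⁻⁴`. All statements are proved; there
are no new definitions.

## References

* J. W. L. Glaisher, Quart. J. Pure Appl. Math. 20 (1885) 313–361.
* [RogersWanZucker2013] M. Rogers, J. G. Wan, I. J. Zucker, *Moments of elliptic integrals and
  critical L-values*, Ramanujan J. 37 (2015) 113–130, arXiv:1303.2259, §3: Thm 1 (the substitution q = exp(−πK′/K)), the Glaisher formula for g, Thm 2.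
* [Lawden1989] D. F. Lawden, *Elliptic Functions and Applications* (1989), §3.8 eqs. (3.8.7),
  (3.8.12); §2.2.
-/

noncomputable section

open Real _root_.MeasureTheory _root_.Set _root_.Filter
open scoped _root_.Topology Real

namespace Literature.Analysis.SpecialFunctions

open Literature.Probability.RandomPlanarGeometry
open Literature.NumberTheory.EllipticCurves.JacobiThetaNull
open LegendreRelation

/-! ### `dK/dk` and `dE/dk` in modulus form -/

/-- **Lawden (3.8.12)**: for `0 < k < 1`, `dK/dk = (E − (1−k²)K)/(k(1−k²))`.
[cite: Lawden1989, §3.8 eq. (3.8.12)] -/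
theorem hasDerivAt_completeEllipticK {k : ℝ} (hk : k ∈ Ioo (0 : ℝ) 1) :
    HasDerivAt completeEllipticK
      ((completeEllipticE k - (1 - k ^ 2) * completeEllipticK k) / (k * (1 - k ^ 2))) k := by
  have hm1 : k ^ 2 < 1 := by nlinarith [hk.1, hk.2]
  set Kt : ℝ → ℝ := fun x => ∫ θ in (0:ℝ)..π / 2, 1 / √(1 - x * sin θ ^ 2) with hKt
  set C : ℝ → ℝ := fun x => ∫ θ in (0:ℝ)..π / 2,
      sin θ ^ 2 / ((1 - x * sin θ ^ 2) * √(1 - x * sin θ ^ 2)) with hC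
  have hfun : completeEllipticK = Kt ∘ fun x : ℝ => x ^ 2 := by
    funext x
    simp only [Function.comp, hKt]
    exact completeEllipticK_eq_Kt x
  have hK : HasDerivAt Kt (1 / 2 * C (k ^ 2)) ((fun x : ℝ => x ^ 2) k) := hasDerivAt_Kt hm1
  have hsq : HasDerivAt (fun x : ℝ => x ^ 2) (2 * k) k := (hasDerivAt_pow 2 k).congr_deriv (by norm_num)
  have hcomp := HasDerivAt.comp (h₂ := Kt) (h := fun x : ℝ => x ^ 2) k hK hsq
  have hcomp' : HasDerivAt completeEllipticK (1 / 2 * C (k ^ 2) * (2 * k)) k := by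
    rw [hfun]; exact hcomp
  refine hcomp'.congr_deriv ?_
  have hCt : k ^ 2 * (1 - k ^ 2) * C (k ^ 2) = completeEllipticE k - (1 - k ^ 2) * completeEllipticK k := by
    rw [completeEllipticE_eq_Et, completeEllipticK_eq_Kt]
    exact Ct_relation hm1
  have hk0 : k ≠ 0 := hk.1.ne'
  have hk1 : 1 - k ^ 2 ≠ 0 := by nlinarith [hk.1, hk.2]
  rw [← hCt]
  field_simp

/-- **Lawden (3.8.7)**: for `0 < k < 1`, `dE/dk = (E − K)/k`. [cite: Lawden1989, §3.8 eq. (3.8.7)] -/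
theorem hasDerivAt_completeEllipticE {k : ℝ} (hk : k ∈ Ioo (0 : ℝ) 1) :
    HasDerivAt completeEllipticE ((completeEllipticE k - completeEllipticK k) / k) k := by
  have hm1 : k ^ 2 < 1 := by nlinarith [hk.1, hk.2]
  set Et : ℝ → ℝ := fun x => ∫ θ in (0:ℝ)..π / 2, √(1 - x * sin θ ^ 2) with hEt
  set D : ℝ → ℝ := fun x => ∫ θ in (0:ℝ)..π / 2, sin θ ^ 2 / √(1 - x * sin θ ^ 2) with hD
  have hfun : completeEllipticE = Et ∘ fun x : ℝ => x ^ 2 := by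
    funext x
    simp only [Function.comp, hEt]
    exact completeEllipticE_eq_Et x
  have hE : HasDerivAt Et (-(1 / 2) * D (k ^ 2)) ((fun x : ℝ => x ^ 2) k) := hasDerivAt_Et hm1
  have hsq : HasDerivAt (fun x : ℝ => x ^ 2) (2 * k) k := (hasDerivAt_pow 2 k).congr_deriv (by norm_num)
  have hcomp := HasDerivAt.comp (h₂ := Et) (h := fun x : ℝ => x ^ 2) k hE hsq
  have hcomp' : HasDerivAt completeEllipticE (-(1 / 2) * D (k ^ 2) * (2 * k)) k := by
    rw [hfun]; exact hcomp
  refine hcomp'.congr_deriv ?_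
  have hEK : completeEllipticE k - completeEllipticK k = -k ^ 2 * D (k ^ 2) := by
    rw [completeEllipticE_eq_Et, completeEllipticK_eq_Kt]
    exact Et_sub_Kt hm1
  have hk0 : k ≠ 0 := hk.1.ne'
  rw [hEK]
  field_simp

/-- `d/dk (E − (1−k²)K) = kK` (the derivative of `W = E − k′²K`). [cite: Lawden1989, §3.8 eqs. (3.8.7), (3.8.12)] -/
theorem hasDerivAt_completeEllipticW {k : ℝ} (hk : k ∈ Ioo (0 : ℝ) 1) :
    HasDerivAt (fun x => completeEllipticE x - (1 - x ^ 2) * completeEllipticK x)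
      (k * completeEllipticK k) k := by
  have hE := hasDerivAt_completeEllipticE hk
  have hK := hasDerivAt_completeEllipticK hk
  have h1 : HasDerivAt (fun x : ℝ => 1 - x ^ 2) (-(2 * k)) k :=
    ((hasDerivAt_pow 2 k).congr_deriv (by norm_num) : HasDerivAt (fun x : ℝ => x ^ 2) (2 * k) k).const_sub 1
  have h := hE.sub (h1.mul hK)
  refine h.congr_deriv ?_
  have hk0 : k ≠ 0 := hk.1.ne'
  have hk1 : 1 - k ^ 2 ≠ 0 := by nlinarith [hk.1, hk.2]
  field_simp
  ring

/-! ### The theta series at the period ratio -/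

/-- Uniqueness of derivatives for functions that agree on `(0,1)`. [folklore] -/
theorem deriv_unique_of_eqOn_Ioo {f g : ℝ → ℝ} {a b k : ℝ} (hk : k ∈ Ioo (0 : ℝ) 1)
    (hfg : ∀ x ∈ Ioo (0 : ℝ) 1, f x = g x) (hf : HasDerivAt f a k) (hg : HasDerivAt g b k) : a = b := by
  have heq : g =ᶠ[𝓝 k] f := by
    filter_upwards [Ioo_mem_nhds hk.1 hk.2] with x hx
    exact (hfg x hx).symm
  exact (hf.congr_of_eventuallyEq heq).unique hg

/-- The period ratio `σ(k) = K′/K` is positive on `(0,1)`. [folklore] -/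
theorem periodRatio_pos {k : ℝ} (hk : k ∈ Ioo (0 : ℝ) 1) :
    0 < completeEllipticK (Real.sqrt (1 - k ^ 2)) / completeEllipticK k := by
  have h : completeEllipticK (Real.sqrt (1 - k ^ 2)) / completeEllipticK k ∈ Ioi (0 : ℝ) := by
    rw [← image_completeEllipticK_ratio]
    exact ⟨k, hk, rfl⟩
  exact h

/-- **Jacobi's inversion in series form**: `(∑ₙ e^{−πn²σ})² = (2/π)K(k)` at `σ = K′(k)/K(k)`,
`0 < k < 1`. [cite: Lawden1989, §2.2 and eq. (2.2.3)] -/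
theorem theta_sq_periodRatio {k : ℝ} (hk : k ∈ Ioo (0 : ℝ) 1) :
    (∑' n : ℤ, rexp (-π * (n : ℝ) ^ 2 * (completeEllipticK (Real.sqrt (1 - k ^ 2)) / completeEllipticK k))) ^ 2 =
      2 / π * completeEllipticK k := by
  have hσ := periodRatio_pos hk
  have h := completeEllipticK_eq_theta3_sq hk
  rw [theta3_I_mul hσ, Complex.ofReal_re] at h
  have hπ : π ≠ 0 := Real.pi_pos.ne'
  -- `h : K = (π/2)·S²`; rewrite its right-hand side back into `K` (not `K` into the series!)
  calc (∑' n : ℤ, rexp (-π * (n : ℝ) ^ 2 * (completeEllipticK (Real.sqrt (1 - k ^ 2)) / completeEllipticK k))) ^ 2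
      = 2 / π * (π / 2 * (∑' n : ℤ, rexp (-π * (n : ℝ) ^ 2 *
          (completeEllipticK (Real.sqrt (1 - k ^ 2)) / completeEllipticK k))) ^ 2) := by
        generalize (∑' n : ℤ, rexp (-π * (n : ℝ) ^ 2 *
          (completeEllipticK (Real.sqrt (1 - k ^ 2)) / completeEllipticK k))) = S
        field_simp
    _ = 2 / π * completeEllipticK k := by rw [← h]

/-- **First derived identity**: `θ(σ)·θ′(σ) = −(2/π²) K² (E − (1−k²)K)` at `σ = K′/K`
(differentiate `θ(σ(k))² = (2/π)K(k)` in `k`, with `dσ/dk = −π/(2kk′²K²)` and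
`dK/dk = (E − k′²K)/(kk′²)`). [cite: RogersWanZucker2013, §3, proof of Thm 1 and Glaisher formula for g] -/
theorem theta_mul_deriv_periodRatio {k : ℝ} (hk : k ∈ Ioo (0 : ℝ) 1) :
    (∑' n : ℤ, rexp (-π * (n : ℝ) ^ 2 * (completeEllipticK (Real.sqrt (1 - k ^ 2)) / completeEllipticK k))) *
      (∑' n : ℤ, (-π * (n : ℝ) ^ 2) *
        rexp (-π * (n : ℝ) ^ 2 * (completeEllipticK (Real.sqrt (1 - k ^ 2)) / completeEllipticK k))) =
      -(2 / π ^ 2) * completeEllipticK k ^ 2 *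
        (completeEllipticE k - (1 - k ^ 2) * completeEllipticK k) := by
  -- notation
  set σf : ℝ → ℝ := fun x => completeEllipticK (Real.sqrt (1 - x ^ 2)) / completeEllipticK x with hσf
  set θr : ℝ → ℝ := fun t => ∑' n : ℤ, rexp (-π * (n : ℝ) ^ 2 * t) with hθr
  set θ1 : ℝ → ℝ := fun t => ∑' n : ℤ, (-π * (n : ℝ) ^ 2) * rexp (-π * (n : ℝ) ^ 2 * t) with hθ1
  show θr (σf k) * θ1 (σf k) =
    -(2 / π ^ 2) * completeEllipticK k ^ 2 * (completeEllipticE k - (1 - k ^ 2) * completeEllipticK k)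
  have hσpos : 0 < σf k := periodRatio_pos hk
  have hk0 : k ≠ 0 := hk.1.ne'
  have hk1 : (0 : ℝ) < 1 - k ^ 2 := by nlinarith [hk.1, hk.2]
  have hKpos : 0 < completeEllipticK k := completeEllipticK_pos (by nlinarith [hk.1, hk.2])
  -- derivatives of both sides of `θ(σ(x))² = (2/π)K(x)`
  have hσ : HasDerivAt σf (-π / (2 * k * (1 - k ^ 2) * completeEllipticK k ^ 2)) k :=
    hasDerivAt_completeEllipticK_ratio hk
  have hθ : HasDerivAt θr (θ1 (σf k)) (σf k) := hasDerivAt_theta_axis hσpos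
  have hcomp : HasDerivAt (fun x => θr (σf x)) (θ1 (σf k) * (-π / (2 * k * (1 - k ^ 2) * completeEllipticK k ^ 2))) k :=
    HasDerivAt.comp (h₂ := θr) (h := σf) k hθ hσ
  have hL : HasDerivAt (fun x => θr (σf x) ^ 2)
      (2 * θr (σf k) * (θ1 (σf k) * (-π / (2 * k * (1 - k ^ 2) * completeEllipticK k ^ 2)))) k := by
    have h := hcomp.pow 2
    refine h.congr_deriv ?_
    rw [show (2 : ℕ) - 1 = 1 from rfl, pow_one]
    push_cast
    ring
  have hR : HasDerivAt (fun x => 2 / π * completeEllipticK x)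
      (2 / π * ((completeEllipticE k - (1 - k ^ 2) * completeEllipticK k) / (k * (1 - k ^ 2)))) k :=
    (hasDerivAt_completeEllipticK hk).const_mul _
  have heq : ∀ x ∈ Ioo (0 : ℝ) 1, θr (σf x) ^ 2 = 2 / π * completeEllipticK x := fun x hx =>
    theta_sq_periodRatio hx
  have hD := deriv_unique_of_eqOn_Ioo hk heq hL hR
  -- solve for `θ(σ)θ′(σ)`
  have hπ : π ≠ 0 := Real.pi_pos.ne'
  have hK0 : completeEllipticK k ≠ 0 := hKpos.ne'
  have hk1' : 1 - k ^ 2 ≠ 0 := hk1.ne'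
  have hs0 : -π / (2 * k * (1 - k ^ 2) * completeEllipticK k ^ 2) ≠ 0 :=
    div_ne_zero (neg_ne_zero.mpr hπ) (by positivity)
  have e : θr (σf k) * θ1 (σf k) =
      (2 / π * ((completeEllipticE k - (1 - k ^ 2) * completeEllipticK k) / (k * (1 - k ^ 2)))) /
        (2 * (-π / (2 * k * (1 - k ^ 2) * completeEllipticK k ^ 2))) := by
    rw [eq_div_iff (mul_ne_zero two_ne_zero hs0)]
    linear_combination hD
  rw [e]
  field_simp

/-- **The Glaisher combination at the period ratio**: `2θ(σ)θ″(σ) − 6θ′(σ)² = (8/π³) k²(1−k²)K⁵` at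
`σ = K′(k)/K(k)`, `0 < k < 1` (differentiate the first derived identity once more, with
`d(E − k′²K)/dk = kK`). [cite: RogersWanZucker2013, §3, Glaisher formula for g before Thm 2; proof of Thm 1] -/
theorem glaisher_combination_periodRatio {k : ℝ} (hk : k ∈ Ioo (0 : ℝ) 1) :
    2 * (∑' n : ℤ, rexp (-π * (n : ℝ) ^ 2 * (completeEllipticK (Real.sqrt (1 - k ^ 2)) / completeEllipticK k))) *
        (∑' n : ℤ, (-π * (n : ℝ) ^ 2) ^ 2 *
          rexp (-π * (n : ℝ) ^ 2 * (completeEllipticK (Real.sqrt (1 - k ^ 2)) / completeEllipticK k))) -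
      6 * (∑' n : ℤ, (-π * (n : ℝ) ^ 2) *
          rexp (-π * (n : ℝ) ^ 2 * (completeEllipticK (Real.sqrt (1 - k ^ 2)) / completeEllipticK k))) ^ 2 =
      8 / π ^ 3 * (k ^ 2 * (1 - k ^ 2)) * completeEllipticK k ^ 5 := by
  -- notation
  set σf : ℝ → ℝ := fun x => completeEllipticK (Real.sqrt (1 - x ^ 2)) / completeEllipticK x with hσf
  set θr : ℝ → ℝ := fun t => ∑' n : ℤ, rexp (-π * (n : ℝ) ^ 2 * t) with hθr
  set θ1 : ℝ → ℝ := fun t => ∑' n : ℤ, (-π * (n : ℝ) ^ 2) * rexp (-π * (n : ℝ) ^ 2 * t) with hθ1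
  set θ2 : ℝ → ℝ := fun t => ∑' n : ℤ, (-π * (n : ℝ) ^ 2) ^ 2 * rexp (-π * (n : ℝ) ^ 2 * t) with hθ2
  set W : ℝ → ℝ := fun x => completeEllipticE x - (1 - x ^ 2) * completeEllipticK x with hW
  show 2 * θr (σf k) * θ2 (σf k) - 6 * θ1 (σf k) ^ 2 = 8 / π ^ 3 * (k ^ 2 * (1 - k ^ 2)) * completeEllipticK k ^ 5
  have hσpos : 0 < σf k := periodRatio_pos hk
  have hk0 : k ≠ 0 := hk.1.ne'
  have hk1 : (0 : ℝ) < 1 - k ^ 2 := by nlinarith [hk.1, hk.2]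
  have hKpos : 0 < completeEllipticK k := completeEllipticK_pos (by nlinarith [hk.1, hk.2])
  have hπ : π ≠ 0 := Real.pi_pos.ne'
  have hK0 : completeEllipticK k ≠ 0 := hKpos.ne'
  have hk1' : 1 - k ^ 2 ≠ 0 := hk1.ne'
  -- the zeroth and first identities at `k`
  have h0 : θr (σf k) ^ 2 = 2 / π * completeEllipticK k := theta_sq_periodRatio hk
  have h1 : θr (σf k) * θ1 (σf k) = -(2 / π ^ 2) * completeEllipticK k ^ 2 * W k :=
    theta_mul_deriv_periodRatio hk
  -- differentiate the first identity along `σf`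
  have hσ : HasDerivAt σf (-π / (2 * k * (1 - k ^ 2) * completeEllipticK k ^ 2)) k :=
    hasDerivAt_completeEllipticK_ratio hk
  set s' : ℝ := -π / (2 * k * (1 - k ^ 2) * completeEllipticK k ^ 2) with hs'
  have hθ : HasDerivAt θr (θ1 (σf k)) (σf k) := hasDerivAt_theta_axis hσpos
  have hθ' : HasDerivAt θ1 (θ2 (σf k)) (σf k) := hasDerivAt_deriv_theta_axis hσpos
  have hc0 : HasDerivAt (fun x => θr (σf x)) (θ1 (σf k) * s') k :=
    HasDerivAt.comp (h₂ := θr) (h := σf) k hθ hσ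
  have hc1 : HasDerivAt (fun x => θ1 (σf x)) (θ2 (σf k) * s') k :=
    HasDerivAt.comp (h₂ := θ1) (h := σf) k hθ' hσ
  have hL : HasDerivAt (fun x => θr (σf x) * θ1 (σf x))
      (θ1 (σf k) * s' * θ1 (σf k) + θr (σf k) * (θ2 (σf k) * s')) k := hc0.mul hc1
  have hR : HasDerivAt (fun x => -(2 / π ^ 2) * completeEllipticK x ^ 2 * W x)
      (-(2 / π ^ 2) * (2 * completeEllipticK k *
          ((completeEllipticE k - (1 - k ^ 2) * completeEllipticK k) / (k * (1 - k ^ 2)))) * W k +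
        -(2 / π ^ 2) * completeEllipticK k ^ 2 * (k * completeEllipticK k)) k := by
    have hK := hasDerivAt_completeEllipticK hk
    have hK2 : HasDerivAt (fun x => completeEllipticK x ^ 2)
        (2 * completeEllipticK k * ((completeEllipticE k - (1 - k ^ 2) * completeEllipticK k) / (k * (1 - k ^ 2)))) k := by
      have h := hK.pow 2
      refine h.congr_deriv ?_
      rw [show (2 : ℕ) - 1 = 1 from rfl, pow_one]
      push_cast
      ring
    have hWd : HasDerivAt W (k * completeEllipticK k) k := hasDerivAt_completeEllipticW hk
    exact ((hK2.const_mul (-(2 / π ^ 2))).mul hWd)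
  have heq : ∀ x ∈ Ioo (0 : ℝ) 1, θr (σf x) * θ1 (σf x) = -(2 / π ^ 2) * completeEllipticK x ^ 2 * W x :=
    fun x hx => theta_mul_deriv_periodRatio hx
  have hD := deriv_unique_of_eqOn_Ioo hk heq hL hR
  -- algebra: eliminate θ′² through h1, h0 and the chain-rule factor s'
  have hθr0 : θr (σf k) ≠ 0 := by
    intro h
    rw [h] at h0
    have : (0 : ℝ) < 2 / π * completeEllipticK k := by positivity
    nlinarith
  have hWk : W k = completeEllipticE k - (1 - k ^ 2) * completeEllipticK k := rfl
  rw [hWk] at h1 hD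
  have hs'0 : s' ≠ 0 := by
    rw [hs']
    have : 0 < 2 * k * (1 - k ^ 2) * completeEllipticK k ^ 2 := by
      have := hk.1; positivity
    have hπ0 : 0 < π := Real.pi_pos
    intro h0'
    rw [div_eq_zero_iff] at h0'
    rcases h0' with h0' | h0'
    · linarith
    · exact this.ne' h0'
  -- `θ′(σ)² = (2/π³) K³ W²`
  have hB2 : θ1 (σf k) ^ 2 = 2 / π ^ 3 * completeEllipticK k ^ 3 *
      (completeEllipticE k - (1 - k ^ 2) * completeEllipticK k) ^ 2 := by
    have hsq : (θr (σf k) * θ1 (σf k)) ^ 2 = θr (σf k) ^ 2 * θ1 (σf k) ^ 2 := mul_pow _ _ 2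
    rw [h1, h0] at hsq
    have hne : 2 / π * completeEllipticK k ≠ 0 := by positivity
    apply mul_left_cancel₀ hne
    rw [← hsq]
    field_simp
  -- `θ(σ)θ″(σ) = (R′ − θ′² s′)/s′`
  have e3 : θr (σf k) * θ2 (σf k) =
      (-(2 / π ^ 2) * (2 * completeEllipticK k *
          ((completeEllipticE k - (1 - k ^ 2) * completeEllipticK k) / (k * (1 - k ^ 2)))) *
          (completeEllipticE k - (1 - k ^ 2) * completeEllipticK k) +
        -(2 / π ^ 2) * completeEllipticK k ^ 2 * (k * completeEllipticK k) - θ1 (σf k) ^ 2 * s') / s' := by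
    rw [eq_div_iff hs'0]
    linear_combination hD
  rw [mul_assoc (2 : ℝ) (θr (σf k)) (θ2 (σf k)), e3, hB2, hs']
  field_simp
  ring

/-- **Glaisher's identity in `K`-form**: for `0 < k < 1` and `σ = K′(k)/K(k)`,
`∑_{(m,n)∈ℤ²} (m⁴ − 6m²n² + n⁴) e^{−π(m²+n²)σ} = (8/π⁵) k²(1−k²) K(k)⁵`.
[cite: RogersWanZucker2013, §3, Glaisher formula for g before Thm 2; proof of Thm 1] -/
theorem glaisherLatticeSum_periodRatio {k : ℝ} (hk : k ∈ Ioo (0 : ℝ) 1) :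
    ∑' v : ℤ × ℤ, ((v.1 : ℝ) ^ 4 - 6 * (v.1 : ℝ) ^ 2 * (v.2 : ℝ) ^ 2 + (v.2 : ℝ) ^ 4) *
        rexp (-π * ((v.1 : ℝ) ^ 2 + (v.2 : ℝ) ^ 2) *
          (completeEllipticK (Real.sqrt (1 - k ^ 2)) / completeEllipticK k)) =
      8 / π ^ 5 * (k ^ 2 * (1 - k ^ 2)) * completeEllipticK k ^ 5 := by
  rw [glaisherLatticeSum_eq_deriv (periodRatio_pos hk), glaisher_combination_periodRatio hk]
  have hπ : π ≠ 0 := Real.pi_pos.ne'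
  field_simp

end Literature.Analysis.SpecialFunctions

end
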